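import Summits.CriticalPhenomena.SAWScalingLimit.Theorems.SAWDevelopingMapHexConjectureRestrictionCocycleWindowTransport
import HarnessLib

/-!
# Crux `HexConjecture` (stmt-CriticalPhenomena-0808), line `root-locality-replaces-loewner`:
SINGLE-DOMAIN floor-ratio transport along an ARBITRARY admissible floor family

Landing target:
`Summits/CriticalPhenomena/SAWScalingLimit/Theorems/SAWDevelopingMapHexConjectureFloorRatioTransport.lean`
(`--supports stmt-CriticalPhenomena-0808`; lead continuation prover-line-stmt-CriticalPhenomena-0808-c6-0).

For ONE admissible family `Λ δ` of a floor domain `(D; a, b)` (exact half-lattice rows `≥ m δ` in the rigid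
balls `B(a, ρ) ∪ B(b, ρ)`, `δ·mid(a δ) → a`, `δ·mid(b δ) → b`, `a δ = s_x`, `b δ = s_{x'}` vertical floor
mid-edges of one row), one conformal package `(Ψ, L, Lb)` with flatness radius `ρ₁ ≤ ρ`, a floor point
`s = a + t` (`0 < t ≤ ρ₁/4`) on `∂D` with boundary value `Ls` of the logarithm, and the MODULUS floor-ratio
limit `hFRM` (quantified over ALL approximating families of the second floor point):
for EVERY floor family `e δ → s` that is eventually a boundary mid-edge `s_y` of the row of the root with a
nonempty walk space, `Z_{Λδ}(a δ, e δ) / Z_{Λδ}(a δ, b δ) → exp((5/8) Re(Ls − Lb))`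
(`floorFamily_ratioTransport`; one-liner `stub_floorFamilyRatioTransport`).
Proof: re-mark `s` as the second point of a Dobrushin domain `Ds` with the same carrier (`exists_remark`);
flatness at `a`, `b`, `s` at radius `ρ₁/2` (`flat_of_subset`); `hFRM` at `(D, Ds; ρ₁/2; Λ; m, m, m; a, b, e)`
gives `‖F(e δ)/F(b δ)‖ → exp((5/8) Re(Ls − Lb))` — literally the block `T₁` of `floorFamily_targetTransport`
(`…RestrictionCocycleWindowTransport.lean`) without the second domain; finally the root cell `x` lies in the
floor row `m δ` (`floorEdge_data` in the rigid ball `B(a, ρ)`, identification of root cells by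
`floorEdge_inj`), so `Λ δ` lies in the rows `≥ x₁` and the deterministic floor-to-floor winding
(`norm_hexParafermionicObservable_floorEdge`) converts `‖F(s_y)/F(s_{x'})‖` into `Z(s_x, s_y)/Z(s_x, s_{x'})`
(`norm_div_hexParafermionicObservable_floorEdge`; one-liner `stub_floorEdgeObservableRatio`).
Sources: LawlerSchrammWerner2004SAW (§3.4, Prop. 2), DuminilCopinSmirnov2012 (Lemma 2).
-/

noncomputable section

open scoped BigOperators Topology NNReal ENNReal Classical
open Filter Set MeasureTheory Metric
open Literature.Probability.LatticeModels (HexVertex hexGraph hexCenter Site)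
open Literature.Probability.RandomPlanarGeometry
open Literature.Probability.RandomPlanarGeometry.SAW
open UpperHalfPlane (upperHalfPlaneSet)

namespace Summit.CriticalPhenomena.SAWScalingLimit.Theorems.HexConjecture.RootLocality

open Summit.CriticalPhenomena.SAWScalingLimit.Theorems.ObservableToSLE.FloorRatio

/-! ### The norm of the observable ratio at two floor mid-edges -/

/-- **`‖F(s_y)/F(s_{y'})‖ = Z_Λ(s_x, s_y)/Z_Λ(s_x, s_{y'})`.**  If `Λ` lies in the rows `≥ x₁` and `s_y`,
`s_{y'}` (`y₁ = y'₁ = x₁`, `y, y' ≠ x`) are two vertical floor mid-edges, the parafermionic observable with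
source `s_x` at `x = x_c`, `σ = 5/8` has `‖F(s_y)‖ = Z_Λ(s_x, s_y)` and `‖F(s_{y'})‖ = Z_Λ(s_x, s_{y'})`
(deterministic winding `∓π` of every walk to the floor), whence the ratio.
[cite: DuminilCopinSmirnov2012, proof of Lemma 2 (winding to α)] -/
theorem norm_div_hexParafermionicObservable_floorEdge (Λ : Finset HexVertex) (x y y' : Site 2)
    (hΛ : ∀ v ∈ Λ, x 1 ≤ v.1 1) (hy : y 1 = x 1) (hyx : y ≠ x) (hy' : y' 1 = x 1) (hy'x : y' ≠ x) :
    ‖hexParafermionicObservable Λ s((x - Pi.single 1 1, 1), (x, 0)) hexCriticalFugacity (5 / 8)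
          s((y - Pi.single 1 1, 1), (y, 0)) /
        hexParafermionicObservable Λ s((x - Pi.single 1 1, 1), (x, 0)) hexCriticalFugacity (5 / 8)
          s((y' - Pi.single 1 1, 1), (y', 0))‖ =
      (∑ γ : HexMidEdgeSAW Λ s((x - Pi.single 1 1, 1), (x, 0)) s((y - Pi.single 1 1, 1), (y, 0)),
          hexCriticalFugacity ^ γ.length) /
        (∑ γ : HexMidEdgeSAW Λ s((x - Pi.single 1 1, 1), (x, 0)) s((y' - Pi.single 1 1, 1), (y', 0)),
          hexCriticalFugacity ^ γ.length) := by
  rw [norm_div, norm_hexParafermionicObservable_floorEdge Λ x y hΛ hy hyx,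
    norm_hexParafermionicObservable_floorEdge Λ x y' hΛ hy' hy'x]

/-- **Registered sub-goal `stub_floorEdgeObservableRatio`** (crux item stmt-CriticalPhenomena-0808, line
`root-locality-replaces-loewner`, lead continuation c6): the norm-of-ratio identity at floor mid-edges
(`norm_div_hexParafermionicObservable_floorEdge`). [cite: DuminilCopinSmirnov2012, proof of Lemma 2 (winding to α)] -/
theorem stub_floorEdgeObservableRatio : ∀ (Λ : Finset Literature.Probability.LatticeModels.HexVertex) (x y y' : Literature.Probability.LatticeModels.Site 2), (∀ v ∈ Λ, x 1 ≤ v.1 1) → y 1 = x 1 → y ≠ x → y' 1 = x 1 → y' ≠ x → ‖Literature.Probability.RandomPlanarGeometry.SAW.hexParafermionicObservable Λ s((x - Pi.single 1 1, 1), (x, 0)) Literature.Probability.RandomPlanarGeometry.SAW.hexCriticalFugacity (5 / 8) s((y - Pi.single 1 1, 1), (y, 0)) / Literature.Probability.RandomPlanarGeometry.SAW.hexParafermionicObservable Λ s((x - Pi.single 1 1, 1), (x, 0)) Literature.Probability.RandomPlanarGeometry.SAW.hexCriticalFugacity (5 / 8) s((y' - Pi.single 1 1, 1), (y', 0))‖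 = (∑ γ : Literature.Probability.RandomPlanarGeometry.SAW.HexMidEdgeSAW Λ s((x - Pi.single 1 1, 1), (x, 0)) s((y - Pi.single 1 1, 1), (y, 0)), Literature.Probability.RandomPlanarGeometry.SAW.hexCriticalFugacity ^ γ.length) / (∑ γ : Literature.Probability.RandomPlanarGeometry.SAW.HexMidEdgeSAW Λ s((x - Pi.single 1 1, 1), (x, 0)) s((y' - Pi.single 1 1, 1), (y', 0)), Literature.Probability.RandomPlanarGeometry.SAW.hexCriticalFugacity ^ γ.length) :=
  fun Λ x y y' hΛ hy hyx hy' hy'x => norm_div_hexParafermionicObservable_floorEdge Λ x y y' hΛ hy hyx hy' hy'x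

/-! ### The root cell lies in the floor row -/

/-- **The root cell is in the floor row.**  Along an admissible family (exact rows `≥ m δ` in the rigid ball
`B(a, ρ)`, `a δ ∈ ∂Λ δ`, `δ·mid(a δ) → a`), eventually `a δ = s_x` for a cell `x` of the row `m δ`.
[cite: DuminilCopinSmirnov2012, §3 (the bottom boundary α)] -/
theorem eventually_rootCell_row (D : DobrushinDomain) (ρ : ℝ) (Λ : ℝ → Finset HexVertex) (m : ℝ → ℤ)
    (a : ℝ → Sym2 HexVertex) (hρ : 0 < ρ)
    (haΛ : ∀ᶠ δ : ℝ in 𝓝[>] 0, a δ ∈ hexDomainBoundary (Λ δ))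
    (hrows : ∀ᶠ δ : ℝ in 𝓝[>] 0, ∀ v : HexVertex, (δ : ℂ) * hexCenter v ∈ ball (D.pt 0) ρ →
      (v ∈ Λ δ ↔ m δ ≤ v.1 1))
    (ha : Tendsto (fun δ : ℝ => (δ : ℂ) * hexMidpoint (a δ)) (𝓝[>] 0) (𝓝 (D.pt 0))) :
    ∀ᶠ δ : ℝ in 𝓝[>] 0, ∃ x : Site 2, x 1 = m δ ∧ a δ = s((x - Pi.single 1 1, 1), (x, 0)) := by
  have hδρ : ∀ᶠ δ : ℝ in 𝓝[>] 0, δ < ρ := mem_nhdsWithin_of_mem_nhds (Iio_mem_nhds hρ)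
  have h1 : ∀ᶠ δ : ℝ in 𝓝[>] 0, dist ((δ : ℂ) * hexMidpoint (a δ)) (D.pt 0) < ρ / 2 :=
    Metric.tendsto_nhds.1 ha _ (half_pos hρ)
  filter_upwards [haΛ, hrows, h1, hδρ, self_mem_nhdsWithin] with δ haΛ hrows h1 h2 hδ
  obtain ⟨x, hx1, hax, -⟩ :=
    floorEdge_data (Λ' := Λ δ) hδ h2 haΛ h1 fun v hv => ⟨hrows v hv, hrows v hv⟩
  exact ⟨x, hx1, hax⟩

/-! ### Single-domain floor-ratio transport along an arbitrary admissible floor family -/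

/-- **SINGLE-DOMAIN FLOOR-RATIO TRANSPORT ALONG AN ARBITRARY ADMISSIBLE FLOOR FAMILY.**  Setting: one
admissible family `Λ δ` of the floor domain `(D; a, b)` (exact rows `≥ m δ` in the rigid balls, `Λ δ` in the
rows `≥ m δ`, `δ·mid(a δ) → a`, `δ·mid(b δ) → b`, `a δ = s_x`, `b δ = s_{x'}` in one row), the conformal
package `(Ψ, L, Lb)` of `D` with flatness radius `ρ₁ ≤ ρ`, a floor point `s = a + t` (`0 < t ≤ ρ₁/4`) on the
frontier with boundary value `Ls` of the logarithm, and the MODULUS floor-ratio limit `hFRM` (quantified over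
all approximating families).  Then for EVERY floor family `e δ → s` that is eventually a boundary mid-edge
`s_y` of `Λ δ` in the row of the root with a nonempty walk space,
`Z_{Λδ}(a δ, e δ) / Z_{Λδ}(a δ, b δ) → exp((5/8) Re(Ls − Lb))`.
[cite: LawlerSchrammWerner2004SAW, §3.4 ("SAW satisfies restriction") and Prop. 2] -/
theorem floorFamily_ratioTransport
    (hFRM : (∀ (D D' : DobrushinDomain) (ρ : ℝ) (Λ : ℝ → Finset HexVertex) (m₀ m m' : ℝ → ℤ)
      (a b b' : ℝ → Sym2 HexVertex) (Φ : ConformalEquiv D.carrier upperHalfPlaneSet)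
      (L : ℂ → ℂ) (Lb Lb' : ℂ),
      D'.carrier = D.carrier → D'.pt 0 = D.pt 0 → 0 < ρ →
      D.carrier ∩ ball (D.pt 0) ρ = {z : ℂ | (D.pt 0).im < z.im} ∩ ball (D.pt 0) ρ →
      D.carrier ∩ ball (D.pt 1) ρ = {z : ℂ | (D.pt 1).im < z.im} ∩ ball (D.pt 1) ρ →
      D.carrier ∩ ball (D'.pt 1) ρ = {z : ℂ | (D'.pt 1).im < z.im} ∩ ball (D'.pt 1) ρ →
      (∀ᶠ δ : ℝ in 𝓝[>] 0,
        hexDomainSimplyConnected (Λ δ) ∧ a δ ∈ hexDomainBoundary (Λ δ) ∧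
        b δ ∈ hexDomainBoundary (Λ δ) ∧ b' δ ∈ hexDomainBoundary (Λ δ) ∧
        Nonempty (HexMidEdgeSAW (Λ δ) (a δ) (b δ)) ∧ Nonempty (HexMidEdgeSAW (Λ δ) (a δ) (b' δ)) ∧
        (hexGraph.induce (↑(Λ δ) : Set HexVertex)).Preconnected ∧
        (∀ v ∈ Λ δ, (δ : ℂ) * hexCenter v ∈ D.carrier) ∧
        (∀ v : HexVertex, (δ : ℂ) * hexCenter v ∈ ball (D.pt 0) ρ → (v ∈ Λ δ ↔ m₀ δ ≤ v.1 1)) ∧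
        (∀ v : HexVertex, (δ : ℂ) * hexCenter v ∈ ball (D.pt 1) ρ → (v ∈ Λ δ ↔ m δ ≤ v.1 1)) ∧
        (∀ v : HexVertex, (δ : ℂ) * hexCenter v ∈ ball (D'.pt 1) ρ → (v ∈ Λ δ ↔ m' δ ≤ v.1 1))) →
      (∀ K : Set ℂ, IsCompact K → K ⊆ D.carrier →
        ∀ᶠ δ : ℝ in 𝓝[>] 0, ∀ v : HexVertex, (δ : ℂ) * hexCenter v ∈ K → v ∈ Λ δ) →
      Tendsto (fun δ : ℝ => (δ : ℂ) * hexMidpoint (a δ)) (𝓝[>] 0) (𝓝 (D.pt 0)) →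
      Tendsto (fun δ : ℝ => (δ : ℂ) * hexMidpoint (b δ)) (𝓝[>] 0) (𝓝 (D.pt 1)) →
      Tendsto (fun δ : ℝ => (δ : ℂ) * hexMidpoint (b' δ)) (𝓝[>] 0) (𝓝 (D'.pt 1)) →
      Tendsto (fun x => ‖Φ x‖) (𝓝[D.carrier] (D.pt 0)) atTop →
      Φ.HasBoundaryValue (D.pt 1) 0 →
      ContinuousOn L D.carrier → (∀ z ∈ D.carrier, Complex.exp (L z) = deriv Φ z) →
      Tendsto L (𝓝[D.carrier] (D.pt 1)) (𝓝 Lb) → Tendsto L (𝓝[D.carrier] (D'.pt 1)) (𝓝 Lb') →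
      Tendsto (fun δ : ℝ =>
        ‖hexParafermionicObservable (Λ δ) (a δ) hexCriticalFugacity (5 / 8) (b' δ) /
          hexParafermionicObservable (Λ δ) (a δ) hexCriticalFugacity (5 / 8) (b δ)‖) (𝓝[>] 0)
        (𝓝 (Real.exp ((5 / 8) * (Lb' - Lb).re)))))
    (D : DobrushinDomain) (ρ : ℝ) (Λ : ℝ → Finset HexVertex) (m : ℝ → ℤ)
    (a b : ℝ → Sym2 HexVertex) (hρ : 0 < ρ)
    (hev : ∀ᶠ δ : ℝ in 𝓝[>] 0,
      hexDomainSimplyConnected (Λ δ) ∧ (hexGraph.induce (↑(Λ δ) : Set HexVertex)).Preconnected ∧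
      a δ ∈ hexDomainBoundary (Λ δ) ∧ b δ ∈ hexDomainBoundary (Λ δ) ∧
      Nonempty (HexMidEdgeSAW (Λ δ) (a δ) (b δ)) ∧
      (∀ v ∈ Λ δ, (δ : ℂ) * hexCenter v ∈ D.carrier ∧ m δ ≤ v.1 1) ∧
      (∀ v : HexVertex, (δ : ℂ) * hexCenter v ∈ ball (D.pt 0) ρ ∪ ball (D.pt 1) ρ →
        (v ∈ Λ δ ↔ m δ ≤ v.1 1)) ∧
      ∃ x x' : Site 2, a δ = s((x - Pi.single 1 1, 1), (x, 0)) ∧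
        b δ = s((x' - Pi.single 1 1, 1), (x', 0)) ∧ x' 1 = x 1 ∧ x' ≠ x)
    (hKΛ : ∀ K : Set ℂ, IsCompact K → K ⊆ D.carrier →
      ∀ᶠ δ : ℝ in 𝓝[>] 0, ∀ v : HexVertex, (δ : ℂ) * hexCenter v ∈ K → v ∈ Λ δ)
    (ha : Tendsto (fun δ : ℝ => (δ : ℂ) * hexMidpoint (a δ)) (𝓝[>] 0) (𝓝 (D.pt 0)))
    (hb : Tendsto (fun δ : ℝ => (δ : ℂ) * hexMidpoint (b δ)) (𝓝[>] 0) (𝓝 (D.pt 1)))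
    {ρ₁ : ℝ} (hρ₁ : 0 < ρ₁) (hρ₁ρ : ρ₁ ≤ ρ)
    (hflat0 : D.carrier ∩ ball (D.pt 0) ρ = {z : ℂ | (D.pt 0).im < z.im} ∩ ball (D.pt 0) ρ)
    (hflat1 : D.carrier ∩ ball (D.pt 1) ρ = {z : ℂ | (D.pt 1).im < z.im} ∩ ball (D.pt 1) ρ)
    (Ψ : ConformalEquiv D.carrier upperHalfPlaneSet) (L : ℂ → ℂ) (Lb : ℂ)
    (hΨinf : Tendsto (fun z => ‖Ψ z‖) (𝓝[D.carrier] (D.pt 0)) atTop)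
    (hΨb : Ψ.HasBoundaryValue (D.pt 1) 0)
    (hLc : ContinuousOn L D.carrier) (hLe : ∀ z ∈ D.carrier, Complex.exp (L z) = deriv Ψ z)
    (hLb : Tendsto L (𝓝[D.carrier] (D.pt 1)) (𝓝 Lb))
    {t : ℝ} (ht0 : 0 < t) (htρ : t ≤ ρ₁ / 4)
    (hsfr : D.pt 0 + (t : ℂ) ∈ frontier D.carrier)
    {Ls : ℂ} (hLs : Tendsto L (𝓝[D.carrier] (D.pt 0 + t)) (𝓝 Ls))
    (e : ℝ → Sym2 HexVertex)
    (he : Tendsto (fun δ : ℝ => (δ : ℂ) * hexMidpoint (e δ)) (𝓝[>] 0) (𝓝 (D.pt 0 + t)))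
    (heE : ∀ᶠ δ : ℝ in 𝓝[>] 0, e δ ∈ hexDomainBoundary (Λ δ) ∧
        Nonempty (HexMidEdgeSAW (Λ δ) (a δ) (e δ)) ∧
        ∃ x yy : Site 2, a δ = s((x - Pi.single 1 1, 1), (x, 0)) ∧
          e δ = s((yy - Pi.single 1 1, 1), (yy, 0)) ∧ yy 1 = x 1 ∧ yy ≠ x) :
    Tendsto (fun δ : ℝ =>
        (∑ γ : HexMidEdgeSAW (Λ δ) (a δ) (e δ), hexCriticalFugacity ^ γ.length) /
          (∑ γ : HexMidEdgeSAW (Λ δ) (a δ) (b δ), hexCriticalFugacity ^ γ.length))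
      (𝓝[>] 0) (𝓝 (Real.exp ((5 / 8) * (Ls - Lb).re))) := by
  have hρ₂ρ : ρ₁ / 2 ≤ ρ := by linarith
  have hf0 := flat_of_subset hflat0 (ball_subset_ball hρ₂ρ) rfl
  have hf1 := flat_of_subset hflat1 (ball_subset_ball hρ₂ρ) rfl
  -- the floor point
  set s : ℂ := D.pt 0 + t with hs
  have hsa : s ≠ D.pt 0 := pt_add_ne ht0
  have hsim : s.im = (D.pt 0).im := by simp [hs]
  have hdist_s : dist s (D.pt 0) = t := by
    rw [hs, dist_eq_norm, add_sub_cancel_left, Complex.norm_real, Real.norm_eq_abs, abs_of_pos ht0]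
  obtain ⟨Ds, hDs_car, hDs0, hDs1⟩ := exists_remark D hsfr hsa
  have hballs : ball s (ρ₁ / 2) ⊆ ball (D.pt 0) ρ₁ := by
    intro z hz
    rw [mem_ball] at hz ⊢
    calc dist z (D.pt 0) ≤ dist z s + dist s (D.pt 0) := dist_triangle _ _ _
      _ < ρ₁ / 2 + t := by rw [hdist_s]; linarith
      _ ≤ ρ₁ := by linarith
  have hballsρ : ball s (ρ₁ / 2) ⊆ ball (D.pt 0) ρ := hballs.trans (ball_subset_ball hρ₁ρ)
  have hfs := flat_of_subset hflat0 hballsρ hsim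
  -- target transport in modulus form in `(D; a; b, s)` with `Λ`
  have T₁ : Tendsto (fun δ : ℝ =>
      ‖hexParafermionicObservable (Λ δ) (a δ) hexCriticalFugacity (5 / 8) (e δ) /
        hexParafermionicObservable (Λ δ) (a δ) hexCriticalFugacity (5 / 8) (b δ)‖) (𝓝[>] 0)
      (𝓝 (Real.exp ((5 / 8) * (Ls - Lb).re))) := by
    refine hFRM D Ds (ρ₁ / 2) Λ m m m a b e Ψ L Lb Ls hDs_car hDs0
      (half_pos hρ₁) hf0 hf1 (by rw [hDs1]; exact hfs) ?_ hKΛ ha hb (by rw [hDs1]; exact he)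
      hΨinf hΨb hLc hLe hLb (by rw [hDs1]; exact hLs)
    filter_upwards [hev, heE] with δ hevδ hF
    obtain ⟨hscΛ, hconn, haΛ, hbΛ, hne_ab, hΛD, hrows, -⟩ := hevδ
    obtain ⟨heΛ, hne_ae, -⟩ := hF
    refine ⟨hscΛ, haΛ, hbΛ, heΛ, hne_ab, hne_ae, hconn, fun v hv => (hΛD v hv).1, ?_, ?_, ?_⟩
    · exact fun v hv => hrows v (Or.inl (ball_subset_ball hρ₂ρ hv))
    · exact fun v hv => hrows v (Or.inr (ball_subset_ball hρ₂ρ hv))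
    · intro v hv
      rw [hDs1] at hv
      exact hrows v (Or.inl (hballsρ hv))
  -- the root cell is in the floor row, so `Λ δ` lies in the rows `≥ x₁`
  have hA := eventually_rootCell_row D ρ Λ m a hρ (hev.mono fun δ h => h.2.2.1)
    (hev.mono fun δ h v hv => h.2.2.2.2.2.2.1 v (Or.inl hv)) ha
  -- conversion of the moduli into partition functions
  refine T₁.congr' ?_
  filter_upwards [hev, heE, hA] with δ hevδ hF hAx
  obtain ⟨-, -, -, -, -, hΛD, -, x₂, x', hax₂, hbx, hx'1, hx'x⟩ := hevδ
  obtain ⟨-, -, x, yy, hax, hex, hyy1, hyyx⟩ := hF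
  obtain ⟨x₃, hx₃1, hax₃⟩ := hAx
  have hxx : x₂ = x := floorEdge_inj (hax₂.symm.trans hax)
  have hxx' : x₃ = x := floorEdge_inj (hax₃.symm.trans hax)
  rw [hxx] at hx'1 hx'x
  rw [hxx'] at hx₃1
  have hrowsΛ : ∀ v ∈ Λ δ, x 1 ≤ v.1 1 := fun v hv => by rw [hx₃1]; exact (hΛD v hv).2
  rw [hax, hbx, hex]
  exact norm_div_hexParafermionicObservable_floorEdge (Λ δ) x yy x' hrowsΛ hyy1 hyyx hx'1 hx'x

/-- **Registered sub-goal `stub_floorFamilyRatioTransport`** (crux item stmt-CriticalPhenomena-0808, line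
`root-locality-replaces-loewner`, lead continuation c6): the single-domain floor-ratio transport along an
arbitrary admissible floor family (`floorFamily_ratioTransport`).
[cite: LawlerSchrammWerner2004SAW, §3.4 ("SAW satisfies restriction") and Prop. 2] -/
theorem stub_floorFamilyRatioTransport : (∀ (D D' : Literature.Probability.RandomPlanarGeometry.DobrushinDomain) (ρ : ℝ) (Λ : ℝ → Finset Literature.Probability.LatticeModels.HexVertex) (m₀ m m' : ℝ → ℤ) (a b b' : ℝ → Sym2 Literature.Probability.LatticeModels.HexVertex) (Φ : Literature.Probability.RandomPlanarGeometry.ConformalEquiv D.carrier UpperHalfPlane.upperHalfPlaneSet) (L : ℂ → ℂ) (Lb Lb' : ℂ), D'.carrier = D.carrier → D'.pt 0 = D.pt 0 → 0 < ρ → D.carrier ∩ Metric.ball (D.pt 0) ρ = {z : ℂ | (D.pt 0).im < z.im} ∩ Metric.ball (D.pt 0) ρ → D.carrier ∩ Metric.ball (D.pt 1) ρ = {z : ℂ | (D.pt 1).im < z.im} ∩ Metric.ball (D.pt 1) ρ → D.carrier ∩ Metric.ball (D'.pt 1) ρ = {z : ℂ | (D'.pt 1).im < z.im} ∩ Metric.ball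 (D'.pt 1) ρ → (∀ᶠ δ : ℝ in nhdsWithin 0 (Set.Ioi 0), Literature.Probability.RandomPlanarGeometry.SAW.hexDomainSimplyConnected (Λ δ) ∧ a δ ∈ Literature.Probability.RandomPlanarGeometry.SAW.hexDomainBoundary (Λ δ) ∧ b δ ∈ Literature.Probability.RandomPlanarGeometry.SAW.hexDomainBoundary (Λ δ) ∧ b' δ ∈ Literature.Probability.RandomPlanarGeometry.SAW.hexDomainBoundary (Λ δ) ∧ Nonempty (Literature.Probability.RandomPlanarGeometry.SAW.HexMidEdgeSAW (Λ δ) (a δ) (b δ)) ∧ Nonempty (Literature.Probability.RandomPlanarGeometry.SAW.HexMidEdgeSAW (Λ δ) (a δ) (b' δ)) ∧ (Literature.Probability.LatticeModels.hexGraph.induce (↑(Λ δ) : Set Literature.Probability.LatticeModels.HexVertex)).Preconnected ∧ (∀ v ∈ Λ δ, (δ : ℂ) * Literature.Probability.LatticeModels.hexCenter v ∈ D.carrier) ∧ (∀ v : Literature.Probability.LatticeModels.HexVertex, (δ : ℂ) * Literature.Probability.LatticeModels.hexCenter v ∈ Metric.ball (D.pt 0) ρ → (v ∈ Λ δ ↔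 m₀ δ ≤ v.1 1)) ∧ (∀ v : Literature.Probability.LatticeModels.HexVertex, (δ : ℂ) * Literature.Probability.LatticeModels.hexCenter v ∈ Metric.ball (D.pt 1) ρ → (v ∈ Λ δ ↔ m δ ≤ v.1 1)) ∧ (∀ v : Literature.Probability.LatticeModels.HexVertex, (δ : ℂ) * Literature.Probability.LatticeModels.hexCenter v ∈ Metric.ball (D'.pt 1) ρ → (v ∈ Λ δ ↔ m' δ ≤ v.1 1))) → (∀ K : Set ℂ, IsCompact K → K ⊆ D.carrier → ∀ᶠ δ : ℝ in nhdsWithin 0 (Set.Ioi 0), ∀ v : Literature.Probability.LatticeModels.HexVertex, (δ : ℂ) * Literature.Probability.LatticeModels.hexCenter v ∈ K → v ∈ Λ δ) → Filter.Tendsto (fun δ : ℝ => (δ : ℂ) * Literature.Probability.RandomPlanarGeometry.SAW.hexMidpoint (a δ)) (nhdsWithin 0 (Set.Ioi 0)) (nhds (D.pt 0)) → Filter.Tendsto (fun δ : ℝ => (δ : ℂ) * Literature.Probability.RandomPlanarGeometry.SAW.hexMidpoint (b δ)) (nhdsWithin 0 (Set.Ioi 0)) (nhds (D.pt 1)) →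 Filter.Tendsto (fun δ : ℝ => (δ : ℂ) * Literature.Probability.RandomPlanarGeometry.SAW.hexMidpoint (b' δ)) (nhdsWithin 0 (Set.Ioi 0)) (nhds (D'.pt 1)) → Filter.Tendsto (fun x => ‖Φ x‖) (nhdsWithin (D.pt 0) D.carrier) Filter.atTop → Φ.HasBoundaryValue (D.pt 1) 0 → ContinuousOn L D.carrier → (∀ z ∈ D.carrier, Complex.exp (L z) = deriv Φ z) → Filter.Tendsto L (nhdsWithin (D.pt 1) D.carrier) (nhds Lb) → Filter.Tendsto L (nhdsWithin (D'.pt 1) D.carrier) (nhds Lb') → Filter.Tendsto (fun δ : ℝ => ‖Literature.Probability.RandomPlanarGeometry.SAW.hexParafermionicObservable (Λ δ) (a δ) Literature.Probability.RandomPlanarGeometry.SAW.hexCriticalFugacity (5 / 8) (b' δ) / Literature.Probability.RandomPlanarGeometry.SAW.hexParafermionicObservable (Λ δ) (a δ) Literature.Probability.RandomPlanarGeometry.SAW.hexCriticalFugacity (5 / 8) (b δ)‖) (nhdsWithin 0 (Set.Ioi 0)) (nhds (Real.exp ((5 / 8) * (Lb' - Lb).re)))) → ∀ (D : Literature.Probability.RandomPlanarGeometry.DobrushinDomain)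 (ρ : ℝ) (Λ : ℝ → Finset Literature.Probability.LatticeModels.HexVertex) (m : ℝ → ℤ) (a b : ℝ → Sym2 Literature.Probability.LatticeModels.HexVertex), 0 < ρ → (∀ᶠ δ : ℝ in nhdsWithin 0 (Set.Ioi 0), Literature.Probability.RandomPlanarGeometry.SAW.hexDomainSimplyConnected (Λ δ) ∧ (Literature.Probability.LatticeModels.hexGraph.induce (↑(Λ δ) : Set Literature.Probability.LatticeModels.HexVertex)).Preconnected ∧ a δ ∈ Literature.Probability.RandomPlanarGeometry.SAW.hexDomainBoundary (Λ δ) ∧ b δ ∈ Literature.Probability.RandomPlanarGeometry.SAW.hexDomainBoundary (Λ δ) ∧ Nonempty (Literature.Probability.RandomPlanarGeometry.SAW.HexMidEdgeSAW (Λ δ) (a δ) (b δ)) ∧ (∀ v ∈ Λ δ, (δ : ℂ) * Literature.Probability.LatticeModels.hexCenter v ∈ D.carrier ∧ m δ ≤ v.1 1) ∧ (∀ v : Literature.Probability.LatticeModels.HexVertex, (δ : ℂ) * Literature.Probability.LatticeModels.hexCenter v ∈ Metric.ball (D.pt 0) ρ ∪ Metric.ball (D.pt 1) ρ → (v ∈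 Λ δ ↔ m δ ≤ v.1 1)) ∧ ∃ x x' : Literature.Probability.LatticeModels.Site 2, a δ = s((x - Pi.single 1 1, 1), (x, 0)) ∧ b δ = s((x' - Pi.single 1 1, 1), (x', 0)) ∧ x' 1 = x 1 ∧ x' ≠ x) → (∀ K : Set ℂ, IsCompact K → K ⊆ D.carrier → ∀ᶠ δ : ℝ in nhdsWithin 0 (Set.Ioi 0), ∀ v : Literature.Probability.LatticeModels.HexVertex, (δ : ℂ) * Literature.Probability.LatticeModels.hexCenter v ∈ K → v ∈ Λ δ) → Filter.Tendsto (fun δ : ℝ => (δ : ℂ) * Literature.Probability.RandomPlanarGeometry.SAW.hexMidpoint (a δ)) (nhdsWithin 0 (Set.Ioi 0)) (nhds (D.pt 0)) → Filter.Tendsto (fun δ : ℝ => (δ : ℂ) * Literature.Probability.RandomPlanarGeometry.SAW.hexMidpoint (b δ)) (nhdsWithin 0 (Set.Ioi 0)) (nhds (D.pt 1)) → ∀ (ρ₁ : ℝ), 0 < ρ₁ → ρ₁ ≤ ρ → D.carrier ∩ Metric.ball (D.pt 0) ρ = {z : ℂ | (D.pt 0).im < z.im} ∩ Metric.ball (D.pt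 0) ρ → D.carrier ∩ Metric.ball (D.pt 1) ρ = {z : ℂ | (D.pt 1).im < z.im} ∩ Metric.ball (D.pt 1) ρ → ∀ (Ψ : Literature.Probability.RandomPlanarGeometry.ConformalEquiv D.carrier UpperHalfPlane.upperHalfPlaneSet) (L : ℂ → ℂ) (Lb : ℂ), Filter.Tendsto (fun z => ‖Ψ z‖) (nhdsWithin (D.pt 0) D.carrier) Filter.atTop → Ψ.HasBoundaryValue (D.pt 1) 0 → ContinuousOn L D.carrier → (∀ z ∈ D.carrier, Complex.exp (L z) = deriv Ψ z) → Filter.Tendsto L (nhdsWithin (D.pt 1) D.carrier) (nhds Lb) → ∀ (t : ℝ), 0 < t → t ≤ ρ₁ / 4 → D.pt 0 + (t : ℂ) ∈ frontier D.carrier → ∀ (Ls : ℂ), Filter.Tendsto L (nhdsWithin (D.pt 0 + t) D.carrier) (nhds Ls) → ∀ (e : ℝ → Sym2 Literature.Probability.LatticeModels.HexVertex), Filter.Tendsto (fun δ : ℝ => (δ : ℂ) * Literature.Probability.RandomPlanarGeometry.SAW.hexMidpoint (e δ)) (nhdsWithin 0 (Set.Ioi 0)) (nhds (D.pt 0 +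 t)) → (∀ᶠ δ : ℝ in nhdsWithin 0 (Set.Ioi 0), e δ ∈ Literature.Probability.RandomPlanarGeometry.SAW.hexDomainBoundary (Λ δ) ∧ Nonempty (Literature.Probability.RandomPlanarGeometry.SAW.HexMidEdgeSAW (Λ δ) (a δ) (e δ)) ∧ ∃ x yy : Literature.Probability.LatticeModels.Site 2, a δ = s((x - Pi.single 1 1, 1), (x, 0)) ∧ e δ = s((yy - Pi.single 1 1, 1), (yy, 0)) ∧ yy 1 = x 1 ∧ yy ≠ x) → Filter.Tendsto (fun δ : ℝ => (∑ γ : Literature.Probability.RandomPlanarGeometry.SAW.HexMidEdgeSAW (Λ δ) (a δ) (e δ), Literature.Probability.RandomPlanarGeometry.SAW.hexCriticalFugacity ^ γ.length) / (∑ γ : Literature.Probability.RandomPlanarGeometry.SAW.HexMidEdgeSAW (Λ δ) (a δ) (b δ), Literature.Probability.RandomPlanarGeometry.SAW.hexCriticalFugacity ^ γ.length)) (nhdsWithin 0 (Set.Ioi 0)) (nhds (Real.exp ((5 / 8) * (Ls - Lb).re))) :=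
  fun hFRM D ρ Λ m a b hρ hev hKΛ ha hb _ρ₁ hρ₁ hρ₁ρ hflat0 hflat1 Ψ L Lb hΨinf hΨb hLc hLe hLb _t ht0 htρ
      hsfr _Ls hLs e he heE =>
    floorFamily_ratioTransport hFRM D ρ Λ m a b hρ hev hKΛ ha hb hρ₁ hρ₁ρ hflat0 hflat1 Ψ L Lb hΨinf hΨb
      hLc hLe hLb ht0 htρ hsfr hLs e he heE

end Summit.CriticalPhenomena.SAWScalingLimit.Theorems.HexConjecture.RootLocality

end
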